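import Mathlib
import Literature.NumberTheory.Irrationality.RhinViola2001.GroupStructureProofs
import HarnessLib

/-!
# Rhin–Viola 2001, §5: the level-4 transformation formula (5.4) — UNCONDITIONAL

Topic `Literature/NumberTheory/Irrationality/RhinViola2001`. G. Rhin, C. Viola, *The group structure for ζ(3)*, Acta Arith.
**97** (2001) 269–293 [RhinViola2001], §4 (4.4) p. 284: "the value of (4.3) `I(h,…,s)/(h!j!k!l!m!q!r!s!)` is invariant under
the action of the permutation group `Φ = ⟨ϕ, χ, ϑ, σ⟩`", and §5 (5.4) p. 288: for the level-4 permutation `ϕϑ²ϕ`,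
`I(h,j,k,l,m,q,r,s) = h!k!l!r!/(m′!r′!h′!q′!) · I(m′, r′, m, h′, q, q′, s, j)`.

`GroupStructure.lean` proved (4.4) for every word in the generators CONDITIONALLY on the three named facts
`hypergeometric_x`, `hypergeometric_z`, `invariance_theta` (`normI_act`); all three are now theorems of the tree and
`GroupStructureProofs.lean` records the UNCONDITIONAL (4.4) as `normI_act_holds` (cells pub-zeta5 / zeta5-irr, 2026-08-27,
feeding `ThetaInvarianceProofs.invariance_theta_holds` of this seat). This short file adds the product form of (4.4)
(`I_mul_factProd_act`) and the printed level-4 representative (5.4) as an unconditional theorem (`level_four_formula`, via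
the statement file's `phi_theta_theta_phi`). Cell pub-zeta5, seat ct-1 g29. HONEST FRAMING: identities between triple
integrals of rational functions; nothing here is an irrationality statement, a measure or a denominator claim; nothing
about `ζ(5)`. Theorems only; no new definition, no new named fact (net debt 0).
-/

noncomputable section

namespace Literature.NumberTheory.Irrationality.RhinViola2001

open scoped Nat

/-- (4.4) in product form: `I(P) · (ϱP)! = I(ϱP) · P!` for every word `ϱ` and admissible `P` (the two factorial
products are the positive integers `h!j!k!l!m!q!r!s!` at `P` and at `ϱP`). [cite: RhinViola2001, §4 (4.4), p. 284] -/
theorem I_mul_factProd_act (w : List Gen) {P : Params} (hP : P.Admissible) :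
    I P * (factProd (act w P) : ℝ) = I (act w P) * (factProd P : ℝ) := by
  have h := normI_act_holds w hP
  unfold normI at h
  have h1 : (factProd (act w P) : ℝ) ≠ 0 := by unfold factProd; positivity
  have h2 : (factProd P : ℝ) ≠ 0 := by unfold factProd; positivity
  field_simp at h
  linarith [h]

/-- **The level-4 formula (5.4)** for the permutation `ϕϑ²ϕ`, unconditionally: for admissible parameters,
`I(h,j,k,l,m,q,r,s) · (m′! r′! h′! q′!) = (h! k! l! r!) · I(m′, r′, m, h′, q, q′, s, j)` (the factorials `j! m! q! s!` common to
both sides of (4.4) cancelled; all sixteen integers are non-negative, so the factorials are those of natural numbers).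
[cite: RhinViola2001, §5 (5.4), p. 288] -/
theorem level_four_formula {P : Params} (hP : P.Admissible) :
    I P * ((Nat.factorial P.aux.m.toNat * Nat.factorial P.aux.r.toNat * Nat.factorial P.aux.h.toNat *
        Nat.factorial P.aux.q.toNat : ℕ) : ℝ) =
      ((Nat.factorial P.h.toNat * Nat.factorial P.k.toNat * Nat.factorial P.l.toNat * Nat.factorial P.r.toNat : ℕ) : ℝ) *
        I ⟨P.aux.m, P.aux.r, P.m, P.aux.h, P.q, P.aux.q, P.s, P.j⟩ := by
  have key := I_mul_factProd_act [.Phi, .Theta, .Theta, .Phi] hP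
  have hw : act [.Phi, .Theta, .Theta, .Phi] P = ⟨P.aux.m, P.aux.r, P.m, P.aux.h, P.q, P.aux.q, P.s, P.j⟩ := by
    have := phi_theta_theta_phi hP.1
    simpa [act, Gen.act] using this
  rw [hw] at key
  -- cancel the common factorials `j! m! q! s!`
  simp only [factProd] at key
  push_cast at key ⊢
  have hj : (0 : ℝ) < (P.j.toNat ! : ℝ) := by positivity
  have hm : (0 : ℝ) < (P.m.toNat ! : ℝ) := by positivity
  have hq : (0 : ℝ) < (P.q.toNat ! : ℝ) := by positivity
  have hs : (0 : ℝ) < (P.s.toNat ! : ℝ) := by positivity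
  have hc : (0 : ℝ) < (P.j.toNat ! : ℝ) * (P.m.toNat ! : ℝ) * (P.q.toNat ! : ℝ) * (P.s.toNat ! : ℝ) := by positivity
  have key' : (I P * ((P.aux.m.toNat ! : ℝ) * (P.aux.r.toNat ! : ℝ) * (P.aux.h.toNat ! : ℝ) * (P.aux.q.toNat ! : ℝ))) *
      ((P.j.toNat ! : ℝ) * (P.m.toNat ! : ℝ) * (P.q.toNat ! : ℝ) * (P.s.toNat ! : ℝ)) =
      (((P.h.toNat ! : ℝ) * (P.k.toNat ! : ℝ) * (P.l.toNat ! : ℝ) * (P.r.toNat ! : ℝ)) *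
        I ⟨P.aux.m, P.aux.r, P.m, P.aux.h, P.q, P.aux.q, P.s, P.j⟩) *
      ((P.j.toNat ! : ℝ) * (P.m.toNat ! : ℝ) * (P.q.toNat ! : ℝ) * (P.s.toNat ! : ℝ)) := by
    linear_combination key
  exact mul_right_cancel₀ hc.ne' key'

end Literature.NumberTheory.Irrationality.RhinViola2001

end
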